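import Summits.BirchSwinnertonDyer.BirchSwinnertonDyer.Theorems.UniversalToricDescentRelaxedLayerTransportTorsion
import Summits.BirchSwinnertonDyer.BirchSwinnertonDyer.Theorems.UniversalToricDescentRelaxedKummerPairCountStrict
import Summits.BirchSwinnertonDyer.BirchSwinnertonDyer.Theorems.AlignedTransportAtTwoMainConjectureOfRankZeroBSDAtTwoFineRoadInfResRel
import Summits.BirchSwinnertonDyer.Rank1Residual.X11b.PropagatedLocalConditions
import HarnessLib

/-!
# The strict Kummer groups `H¹_{str(T∪∞)}(L, E_L[p^k])` through a transport `(Φ^M, Φ)`: conditions in `Γ_K`-terms, and the TRANSFER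
# to a deeper level `U' ≤ U` (crux ♭T≤ stmt-BirchSwinnertonDyer-23042, line `sigmacongruence`, stub R1 `stub_relaxedImageCount`, brick (d) part 1)

Route `UniversalToricDescent`, lead prover `bsd-wall-utd-p1` g18. THEOREMS ONLY (no definition, no named fact, no `sorry`);
`--supports stmt-BirchSwinnertonDyer-23042`. BSD is not proved by any of this.

Setting: `K ⊆ L` number fields, `E = W/K` elliptic, `p` prime, `k : ℕ`, a normal subgroup `U ≤ Γ_K` and a pair of maps
`Φ^M : H¹(Γ_L, E_L[p^k]) →+ H¹(U, E[p^k])`, `Φ = (E[p^k] ↪ E[p^∞])_* ∘ Φ^M` satisfying the two place-wise dictionaries of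
`…RelaxedLayerTransportTorsion(Primary)` (taken as HYPOTHESES `hdict`, `hkum`, so that this file does not depend on how the transport is
built); `T_K` a finite set of finite places of `K`, `T_L` the places of `L` over `T_K`, and the Poitou–Tate-world group
`KS_L(T) = H¹_{kummerStrict(T_L ∪ ∞)}(L, E_L[p^k])` (strict at `T_L` and at the infinite places, Kummer elsewhere) of `…RelaxedKummerPairCountStrict`.

* §1 `conditions_of_mem_kummerStrict` / `mem_kummerStrict_of_conditions` — `y ∈ KS_L(T)` IFF «`conj_σ (Φ y)` classical at every
  finite `u ∉ T_K`» and «`conj_σ (Φ^M y)` locally trivial at every `u ∈ T_K`» (all `σ ∈ Γ_K`; `L` totally complex for `←`);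
  `mem_kummerStrict_union_iff` — adding the strict place set `V_L` over `v ∉ T_K` adds exactly «`conj_σ (Φ^M y) ∈ awayKer U E[p^k] v` ∀σ».
* §2 **`exists_transfer`** — for a second level `(L', U', Φ^M', Φ')` with `U' ≤ U` and `Φ^M'` SURJECTIVE: every `y ∈ KS_L(T)` has a
  `y' ∈ KS_{L'}(T)` with `Φ^M' y' = res_{U'≤U} (Φ^M y)` and `Φ' y' = res_{U'≤U} (Φ y)` (no field map `L → L'` is needed: the transfer
  runs through `Γ_K`). This is the engine of the dual-term chain of the relaxed count road.

References: [GreenbergLNM1716] §2 (local conditions at the primes above a prime of `F`), §3 (Lemma 3.1, passing to the layers);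
[Howard2004HeegnerKolyvagin] Def. 2.1.1 (strict/relaxed Selmer structures); [MilneADT2006] I.§6; [SerreGaloisCohomology1997] I.§2.5.
-/

set_option linter.dupNamespace false
set_option autoImplicit false

noncomputable section
open scoped Classical
open CategoryTheory Field NumberField IsDedekindDomain Function
open Literature.NumberTheory.EllipticCurves Literature.NumberTheory.EllipticCurves.GreenbergSelmer
open Literature.NumberTheory.GaloisRepresentations
open Literature.NumberTheory.GaloisRepresentations.DiscreteGaloisModule (SelmerStructure)
open Literature.NumberTheory.GaloisCohomology
open scoped ContRepresentation
open scoped NumberField.LiesOver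

namespace Summit.BirchSwinnertonDyer.BirchSwinnertonDyer.Theorems.UniversalToricDescentRelaxedDualTransfer

open Summit.BirchSwinnertonDyer.Rank1Residual.X11b.KummerPT Summit.BirchSwinnertonDyer.Rank1Residual.X11b.LocBridge
  Summit.BirchSwinnertonDyer.BirchSwinnertonDyer.Theorems.SignedEC.RelaxedKummerCount
  Summit.BirchSwinnertonDyer.BirchSwinnertonDyer.Theorems.UniversalToricDescentRelaxedLayerTransportTorsion
  Summit.BirchSwinnertonDyer.BirchSwinnertonDyer.Theorems.AlignedTransportAtTwoFineRoad

variable {K : Type} [Field K] [NumberField K] (W : WeierstrassCurve K) (p k : ℕ) (TK : Finset (HeightOneSpectrum (𝓞 K)))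

/-! ## §0 Places over a place -/

section Places

variable {L : Type} [Field L] [NumberField L] [Algebra K L]

omit [NumberField K] [NumberField L] in
/-- `w` lies over `w.under`. [folklore] -/
theorem liesOver_under (w : HeightOneSpectrum (𝓞 L)) : w.asIdeal.LiesOver (w.under (𝓞 K)).asIdeal :=
  ⟨rfl⟩

omit [NumberField K] [NumberField L] in
/-- The place below is unique: `w ∣ u` iff `w.under = u`. [folklore] -/
theorem liesOver_iff_under_eq (w : HeightOneSpectrum (𝓞 L)) (u : HeightOneSpectrum (𝓞 K)) :
    w.asIdeal.LiesOver u.asIdeal ↔ w.under (𝓞 K) = u := by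
  constructor
  · intro h
    exact HeightOneSpectrum.ext h.over.symm
  · rintro rfl
    exact liesOver_under w

end Places

/-! ## §1 One level: `KS_L(T)` in `Γ_K`-terms -/

section OneLevel

variable (L : Type) [Field L] [NumberField L] [Algebra K L]
  (U : Subgroup (absoluteGaloisGroup K)) [U.Normal]
  (ΦM : galoisCohomology ((W.baseChange L).torsionGaloisModule ((p ^ k : ℕ) : ℤ)) 1 →+ subgroupH1 U (W.geomTorsion ((p ^ k : ℕ) : ℤ)))
  (Φ : galoisCohomology ((W.baseChange L).torsionGaloisModule ((p ^ k : ℕ) : ℤ)) 1 →+ W.subgroupH1 p U)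
  (hdict : ∀ (u : HeightOneSpectrum (𝓞 K)) (z : galoisCohomology ((W.baseChange L).torsionGaloisModule ((p ^ k : ℕ) : ℤ)) 1),
    (∀ w : HeightOneSpectrum (𝓞 L), w.asIdeal.LiesOver u.asIdeal →
      galoisCohomology.localization ((W.baseChange L).torsionGaloisModule ((p ^ k : ℕ) : ℤ)) (Sum.inr w) 1 z = 0) ↔
    ∀ σ : absoluteGaloisGroup K,
      conjH1 U (W.geomTorsion ((p ^ k : ℕ) : ℤ)) σ (ΦM z) ∈ awayKer U (W.geomTorsion ((p ^ k : ℕ) : ℤ)) u)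
  (hkum : ∀ (u : HeightOneSpectrum (𝓞 K)) (x : galoisCohomology ((W.baseChange L).torsionGaloisModule ((p ^ k : ℕ) : ℤ)) 1),
    (∀ w : HeightOneSpectrum (𝓞 L), w.asIdeal.LiesOver u.asIdeal →
      galoisCohomology.res ((W.baseChange L).torsionGaloisModule ((p ^ k : ℕ) : ℤ)) (w.adicCompletion L) 1 x ∈
        (W.baseChange L).kummerLocalConditionAt ((p ^ k : ℕ) : ℤ) (w.adicCompletion L)) ↔
    ∀ σ : absoluteGaloisGroup K, W.conjH1 p U σ (Φ x) ∈ W.localKerOver p U (u.adicCompletion K))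
  (TL : Finset (HeightOneSpectrum (𝓞 L))) (hTL : ∀ w, w ∈ TL ↔ w.under (𝓞 K) ∈ TK)

omit [NumberField K] in
include hTL in
/-- A finite place of `L` is in `T_L ∪ ∞` iff it lies over `T_K`. [folklore] -/
theorem inr_mem_iff (w : HeightOneSpectrum (𝓞 L)) :
    (Sum.inr w : Place L) ∈ TL.image Sum.inr ∪ Finset.univ.image Sum.inl ↔ w.under (𝓞 K) ∈ TK := by
  rw [← hTL]
  simp [Finset.mem_union, Finset.mem_image]

omit [NumberField K] in
/-- An infinite place of `L` is in `T_L ∪ ∞`. [folklore] -/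
theorem inl_mem (w : InfinitePlace L) : (Sum.inl w : Place L) ∈ TL.image Sum.inr ∪ Finset.univ.image Sum.inl := by
  simp [Finset.mem_union, Finset.mem_image]

include hdict hkum hTL in
/-- **`y ∈ KS_L(T)` ⟹ the `Γ_K`-side conditions**: `conj_σ (Φ y)` classical at every finite `u ∉ T_K`, and `conj_σ (Φ^M y)` locally
trivial at every `u ∈ T_K` (all `σ`). [cite: GreenbergLNM1716, §2 (pp. 62–63)] [cite: Howard2004HeegnerKolyvagin, Def. 2.1.1] -/
theorem conditions_of_mem_kummerStrict {y : galoisCohomology ((W.baseChange L).torsionGaloisModule ((p ^ k : ℕ) : ℤ)) 1}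
    (hy : y ∈ (kummerStrict (W.baseChange L) (p ^ k) (TL.image Sum.inr ∪ Finset.univ.image Sum.inl)).selmerGroup) :
    (∀ u : HeightOneSpectrum (𝓞 K), u ∉ TK → ∀ σ : absoluteGaloisGroup K,
        W.conjH1 p U σ (Φ y) ∈ W.localKerOver p U (u.adicCompletion K)) ∧
      ∀ u ∈ TK, ∀ σ : absoluteGaloisGroup K,
        conjH1 U (W.geomTorsion ((p ^ k : ℕ) : ℤ)) σ (ΦM y) ∈ awayKer U (W.geomTorsion ((p ^ k : ℕ) : ℤ)) u := by
  rw [SelmerStructure.mem_selmerGroup_iff] at hy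
  constructor
  · intro u hu
    rw [← hkum u y]
    intro w hw
    have hw' : w.under (𝓞 K) = u := (liesOver_iff_under_eq w u).mp hw
    have hnot : (Sum.inr w : Place L) ∉ TL.image Sum.inr ∪ Finset.univ.image Sum.inl := by
      rw [inr_mem_iff TK L TL hTL, hw']
      exact hu
    have h := hy (Sum.inr w)
    rw [kummerStrict_of_not_mem _ _ _ hnot] at h
    exact h
  · intro u hu
    rw [← hdict u y]
    intro w hw
    have hw' : w.under (𝓞 K) = u := (liesOver_iff_under_eq w u).mp hw
    have hmem : (Sum.inr w : Place L) ∈ TL.image Sum.inr ∪ Finset.univ.image Sum.inl := by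
      rw [inr_mem_iff TK L TL hTL, hw']
      exact hu
    have h := hy (Sum.inr w)
    rw [kummerStrict_of_mem _ _ _ hmem, AddSubgroup.mem_bot] at h
    exact h

include hdict hkum hTL in
/-- **The `Γ_K`-side conditions ⟹ `z ∈ KS_L(T)`** (`L` totally complex: the strict condition at the infinite places is empty).
[cite: GreenbergLNM1716, §2 (pp. 62–63), §3 p. 87] [cite: Howard2004HeegnerKolyvagin, Def. 2.1.1] -/
theorem mem_kummerStrict_of_conditions (hL : ∀ w : InfinitePlace L, w.IsComplex)
    {z : galoisCohomology ((W.baseChange L).torsionGaloisModule ((p ^ k : ℕ) : ℤ)) 1}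
    (h1 : ∀ u : HeightOneSpectrum (𝓞 K), u ∉ TK → ∀ σ : absoluteGaloisGroup K,
        W.conjH1 p U σ (Φ z) ∈ W.localKerOver p U (u.adicCompletion K))
    (h2 : ∀ u ∈ TK, ∀ σ : absoluteGaloisGroup K,
        conjH1 U (W.geomTorsion ((p ^ k : ℕ) : ℤ)) σ (ΦM z) ∈ awayKer U (W.geomTorsion ((p ^ k : ℕ) : ℤ)) u) :
    z ∈ (kummerStrict (W.baseChange L) (p ^ k) (TL.image Sum.inr ∪ Finset.univ.image Sum.inl)).selmerGroup := by
  rw [SelmerStructure.mem_selmerGroup_iff]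
  rintro (w | w)
  · -- infinite place: strict, and `H¹(L_w, ·) = 0`
    rw [kummerStrict_of_mem _ _ _ (inl_mem L TL w), localization_inl_eq_zero_of_isComplex _ (hL w)]
    exact AddSubgroup.zero_mem _
  · by_cases hw : w.under (𝓞 K) ∈ TK
    · rw [kummerStrict_of_mem _ _ _ ((inr_mem_iff TK L TL hTL w).mpr hw), AddSubgroup.mem_bot]
      exact (hdict (w.under (𝓞 K)) z).mpr (h2 _ hw) w (liesOver_under w)
    · rw [kummerStrict_of_not_mem _ _ _ (fun h ↦ hw ((inr_mem_iff TK L TL hTL w).mp h))]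
      exact (hkum (w.under (𝓞 K)) z).mpr (h1 _ hw) w (liesOver_under w)

include hdict hTL in
/-- **Adding strict places over `v ∉ T_K` adds exactly local triviality at `v`**: for the place set `V_L` of `L` over `v`,
`z ∈ KS_L(T ∪ V)` iff `z ∈ KS_L(T)` and `conj_σ (Φ^M z) ∈ awayKer U E[p^k] v` for all `σ`.
[cite: Howard2004HeegnerKolyvagin, Def. 2.1.1] [cite: GreenbergLNM1716, §2 (pp. 62–63)] -/
theorem mem_kummerStrict_union_iff {v : HeightOneSpectrum (𝓞 K)}
    (VL : Finset (HeightOneSpectrum (𝓞 L))) (hVL : ∀ w, w ∈ VL ↔ w.under (𝓞 K) = v)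
    (z : galoisCohomology ((W.baseChange L).torsionGaloisModule ((p ^ k : ℕ) : ℤ)) 1) :
    z ∈ (kummerStrict (W.baseChange L) (p ^ k) ((TL.image Sum.inr ∪ Finset.univ.image Sum.inl) ∪ VL.image Sum.inr)).selmerGroup ↔
      z ∈ (kummerStrict (W.baseChange L) (p ^ k) (TL.image Sum.inr ∪ Finset.univ.image Sum.inl)).selmerGroup ∧
        ∀ σ : absoluteGaloisGroup K,
          conjH1 U (W.geomTorsion ((p ^ k : ℕ) : ℤ)) σ (ΦM z) ∈ awayKer U (W.geomTorsion ((p ^ k : ℕ) : ℤ)) v := by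
  have hinr : ∀ w : HeightOneSpectrum (𝓞 L),
      (Sum.inr w : Place L) ∈ (TL.image Sum.inr ∪ Finset.univ.image Sum.inl) ∪ VL.image Sum.inr ↔
        w.under (𝓞 K) ∈ TK ∨ w.under (𝓞 K) = v := by
    intro w
    rw [Finset.mem_union, inr_mem_iff TK L TL hTL, ← hVL]
    simp [Finset.mem_image]
  have hinl : ∀ w : InfinitePlace L, (Sum.inl w : Place L) ∈ (TL.image Sum.inr ∪ Finset.univ.image Sum.inl) ∪ VL.image Sum.inr :=
    fun w ↦ Finset.mem_union_left _ (inl_mem L TL w)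
  rw [SelmerStructure.mem_selmerGroup_iff, SelmerStructure.mem_selmerGroup_iff, ← hdict v z]
  constructor
  · intro h
    refine ⟨?_, fun w hw ↦ ?_⟩
    · rintro (w | w)
      · have h' := h (Sum.inl w)
        rw [kummerStrict_of_mem _ _ _ (hinl w)] at h'
        rw [kummerStrict_of_mem _ _ _ (inl_mem L TL w)]
        exact h'
      · by_cases hw : w.under (𝓞 K) ∈ TK
        · have h' := h (Sum.inr w)
          rw [kummerStrict_of_mem _ _ _ ((hinr w).mpr (Or.inl hw))] at h'
          rw [kummerStrict_of_mem _ _ _ ((inr_mem_iff TK L TL hTL w).mpr hw)]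
          exact h'
        · have hwv : ¬ (w.under (𝓞 K) ∈ TK ∨ w.under (𝓞 K) = v) ∨ w.under (𝓞 K) = v := by
            by_cases h' : w.under (𝓞 K) = v
            · exact Or.inr h'
            · exact Or.inl (fun h'' ↦ h''.elim hw h')
          rw [kummerStrict_of_not_mem _ _ _ (fun h' ↦ hw ((inr_mem_iff TK L TL hTL w).mp h'))]
          rcases hwv with hwv | hwv
          · have h' := h (Sum.inr w)
            rw [kummerStrict_of_not_mem _ _ _ (fun h'' ↦ hwv ((hinr w).mp h''))] at h'
            exact h'
          · -- `w ∣ v`: strict in the bigger structure, hence `0`, hence Kummer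
            have h' := h (Sum.inr w)
            rw [kummerStrict_of_mem _ _ _ ((hinr w).mpr (Or.inr hwv)), AddSubgroup.mem_bot] at h'
            rw [h']
            exact AddSubgroup.zero_mem _
    · have h' := h (Sum.inr w)
      rw [kummerStrict_of_mem _ _ _ ((hinr w).mpr (Or.inr ((liesOver_iff_under_eq w v).mp hw))), AddSubgroup.mem_bot] at h'
      exact h'
  · rintro ⟨h, hV⟩ (w | w)
    · rw [kummerStrict_of_mem _ _ _ (hinl w)]
      have h' := h (Sum.inl w)
      rw [kummerStrict_of_mem _ _ _ (inl_mem L TL w)] at h'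
      exact h'
    · by_cases hw : w.under (𝓞 K) ∈ TK
      · rw [kummerStrict_of_mem _ _ _ ((hinr w).mpr (Or.inl hw))]
        have h' := h (Sum.inr w)
        rw [kummerStrict_of_mem _ _ _ ((inr_mem_iff TK L TL hTL w).mpr hw)] at h'
        exact h'
      · by_cases hwv : w.under (𝓞 K) = v
        · rw [kummerStrict_of_mem _ _ _ ((hinr w).mpr (Or.inr hwv)), AddSubgroup.mem_bot]
          exact hV w ((liesOver_iff_under_eq w v).mpr hwv)
        · rw [kummerStrict_of_not_mem _ _ _ (fun h' ↦ ((hinr w).mp h').elim hw hwv)]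
          have h' := h (Sum.inr w)
          rw [kummerStrict_of_not_mem _ _ _ (fun h'' ↦ hw ((inr_mem_iff TK L TL hTL w).mp h''))] at h'
          exact h'

end OneLevel

/-! ## §2 Two levels: the transfer -/

section TwoLevels

variable (L : Type) [Field L] [NumberField L] [Algebra K L]
  (U : Subgroup (absoluteGaloisGroup K)) [U.Normal]
  (ΦM : galoisCohomology ((W.baseChange L).torsionGaloisModule ((p ^ k : ℕ) : ℤ)) 1 →+ subgroupH1 U (W.geomTorsion ((p ^ k : ℕ) : ℤ)))
  (Φ : galoisCohomology ((W.baseChange L).torsionGaloisModule ((p ^ k : ℕ) : ℤ)) 1 →+ W.subgroupH1 p U)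
  (hΦ : ∀ z, Φ z = resH1Hom (ContinuousMonoidHom.id U)
    (AddSubgroup.inclusion (Literature.Barriers.BirchSwinnertonDyer.geomTorsion_pow_le_geomPrimaryTorsion W p k)) (fun _ _ ↦ rfl) (ΦM z))
  (hdict : ∀ (u : HeightOneSpectrum (𝓞 K)) (z : galoisCohomology ((W.baseChange L).torsionGaloisModule ((p ^ k : ℕ) : ℤ)) 1),
    (∀ w : HeightOneSpectrum (𝓞 L), w.asIdeal.LiesOver u.asIdeal →
      galoisCohomology.localization ((W.baseChange L).torsionGaloisModule ((p ^ k : ℕ) : ℤ)) (Sum.inr w) 1 z = 0) ↔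
    ∀ σ : absoluteGaloisGroup K,
      conjH1 U (W.geomTorsion ((p ^ k : ℕ) : ℤ)) σ (ΦM z) ∈ awayKer U (W.geomTorsion ((p ^ k : ℕ) : ℤ)) u)
  (hkum : ∀ (u : HeightOneSpectrum (𝓞 K)) (x : galoisCohomology ((W.baseChange L).torsionGaloisModule ((p ^ k : ℕ) : ℤ)) 1),
    (∀ w : HeightOneSpectrum (𝓞 L), w.asIdeal.LiesOver u.asIdeal →
      galoisCohomology.res ((W.baseChange L).torsionGaloisModule ((p ^ k : ℕ) : ℤ)) (w.adicCompletion L) 1 x ∈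
        (W.baseChange L).kummerLocalConditionAt ((p ^ k : ℕ) : ℤ) (w.adicCompletion L)) ↔
    ∀ σ : absoluteGaloisGroup K, W.conjH1 p U σ (Φ x) ∈ W.localKerOver p U (u.adicCompletion K))
  (TL : Finset (HeightOneSpectrum (𝓞 L))) (hTL : ∀ w, w ∈ TL ↔ w.under (𝓞 K) ∈ TK)
  -- the second level
  (L' : Type) [Field L'] [NumberField L'] [Algebra K L']
  (U' : Subgroup (absoluteGaloisGroup K)) [U'.Normal] (hUU' : U' ≤ U)
  (ΦM' : galoisCohomology ((W.baseChange L').torsionGaloisModule ((p ^ k : ℕ) : ℤ)) 1 →+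
    subgroupH1 U' (W.geomTorsion ((p ^ k : ℕ) : ℤ)))
  (Φ' : galoisCohomology ((W.baseChange L').torsionGaloisModule ((p ^ k : ℕ) : ℤ)) 1 →+ W.subgroupH1 p U')
  (hΦ' : ∀ z, Φ' z = resH1Hom (ContinuousMonoidHom.id U')
    (AddSubgroup.inclusion (Literature.Barriers.BirchSwinnertonDyer.geomTorsion_pow_le_geomPrimaryTorsion W p k)) (fun _ _ ↦ rfl) (ΦM' z))
  (hsurj' : Function.Surjective ΦM')
  (hdict' : ∀ (u : HeightOneSpectrum (𝓞 K)) (z : galoisCohomology ((W.baseChange L').torsionGaloisModule ((p ^ k : ℕ) : ℤ)) 1),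
    (∀ w : HeightOneSpectrum (𝓞 L'), w.asIdeal.LiesOver u.asIdeal →
      galoisCohomology.localization ((W.baseChange L').torsionGaloisModule ((p ^ k : ℕ) : ℤ)) (Sum.inr w) 1 z = 0) ↔
    ∀ σ : absoluteGaloisGroup K,
      conjH1 U' (W.geomTorsion ((p ^ k : ℕ) : ℤ)) σ (ΦM' z) ∈ awayKer U' (W.geomTorsion ((p ^ k : ℕ) : ℤ)) u)
  (hkum' : ∀ (u : HeightOneSpectrum (𝓞 K)) (x : galoisCohomology ((W.baseChange L').torsionGaloisModule ((p ^ k : ℕ) : ℤ)) 1),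
    (∀ w : HeightOneSpectrum (𝓞 L'), w.asIdeal.LiesOver u.asIdeal →
      galoisCohomology.res ((W.baseChange L').torsionGaloisModule ((p ^ k : ℕ) : ℤ)) (w.adicCompletion L') 1 x ∈
        (W.baseChange L').kummerLocalConditionAt ((p ^ k : ℕ) : ℤ) (w.adicCompletion L')) ↔
    ∀ σ : absoluteGaloisGroup K, W.conjH1 p U' σ (Φ' x) ∈ W.localKerOver p U' (u.adicCompletion K))
  (TL' : Finset (HeightOneSpectrum (𝓞 L'))) (hTL' : ∀ w, w ∈ TL' ↔ w.under (𝓞 K) ∈ TK)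

include hΦ hdict hkum hTL hΦ' hsurj' hdict' hkum' hTL' in
/-- **Transfer to a deeper level.** For `U' ≤ U` and `Φ^M'` surjective, every `y ∈ KS_L(T)` has a `y' ∈ KS_{L'}(T)` with
`Φ^M' y' = res_{U' ≤ U} (Φ^M y)` and `Φ' y' = res_{U' ≤ U} (Φ y)` (`L'` totally complex). The local conditions transfer because
restriction `U' ≤ U` commutes with conjugation and preserves `awayKer` and `localKerOver`.
[cite: GreenbergLNM1716, §3 (proof of Lemma 3.1: comparing the Selmer groups of the layers)] [cite: SerreGaloisCohomology1997, I.§2.5] -/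
theorem exists_transfer (hL' : ∀ w : InfinitePlace L', w.IsComplex)
    {y : galoisCohomology ((W.baseChange L).torsionGaloisModule ((p ^ k : ℕ) : ℤ)) 1}
    (hy : y ∈ (kummerStrict (W.baseChange L) (p ^ k) (TL.image Sum.inr ∪ Finset.univ.image Sum.inl)).selmerGroup) :
    ∃ y' : galoisCohomology ((W.baseChange L').torsionGaloisModule ((p ^ k : ℕ) : ℤ)) 1,
      y' ∈ (kummerStrict (W.baseChange L') (p ^ k) (TL'.image Sum.inr ∪ Finset.univ.image Sum.inl)).selmerGroup ∧
      ΦM' y' = resOfLe (W.geomTorsion ((p ^ k : ℕ) : ℤ)) hUU' (ΦM y) ∧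
      Φ' y' = W.resOfLe p hUU' (Φ y) := by
  obtain ⟨h1, h2⟩ := conditions_of_mem_kummerStrict W p k TK L U ΦM Φ hdict hkum TL hTL hy
  obtain ⟨y', hy'⟩ := hsurj' (resOfLe (W.geomTorsion ((p ^ k : ℕ) : ℤ)) hUU' (ΦM y))
  have hΦ'y' : Φ' y' = W.resOfLe p hUU' (Φ y) := by
    rw [hΦ' y', hy', hΦ y]
    exact (resOfLe_resH1Hom_id _ (fun _ _ ↦ rfl) hUU' (ΦM y)).symm
  refine ⟨y', ?_, hy', hΦ'y'⟩
  refine mem_kummerStrict_of_conditions W p k TK L' U' ΦM' Φ' hdict' hkum' TL' hTL' hL' (fun u hu σ ↦ ?_) (fun u hu σ ↦ ?_)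
  · -- Kummer off `T_K`: restriction preserves the classical condition
    rw [hΦ'y']
    have e := congrArg (fun f ↦ f (Φ y)) (resOfLe_comp_conjH1_holds (M := W.geomPrimaryTorsion p) hUU' σ)
    simp only [AddMonoidHom.coe_comp, Function.comp_apply] at e
    change W.conjH1 p U' σ (W.resOfLe p hUU' (Φ y)) ∈ _
    rw [← e]
    exact W.resOfLe_mem_localKerOver p _ hUU' (h1 u hu σ)
  · -- strict on `T_K`: restriction preserves local triviality
    rw [hy']
    have e := congrArg (fun f ↦ f (ΦM y)) (resOfLe_comp_conjH1_holds (M := W.geomTorsion ((p ^ k : ℕ) : ℤ)) hUU' σ)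
    simp only [AddMonoidHom.coe_comp, Function.comp_apply] at e
    rw [← e]
    exact InfResRel.resOfLe_mem_awayKer _ hUU' u (h2 u hu σ)

end TwoLevels

end Summit.BirchSwinnertonDyer.BirchSwinnertonDyer.Theorems.UniversalToricDescentRelaxedDualTransfer

end
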